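import Mathlib
import HarnessLib
import Summits.Parity.BatemanHorn.Theorems.OneSidedDegreeLadderNormFormSlicesDefs
import Literature.NumberTheory.Sieve.ParityWave0

/-!
# `OneSidedDegreeLadder` — the norm-form slice identities (hand (b): THEOREMS ONLY)

decomp-parity node B1.1.5 «NormFormSliceLadder» (lens-1 g8; kernel §2 + the binary addendum; critic row 96; writer
DECISION 2026-08-30T12:35:37Z), the ALGEBRA of the move.  For MONIC `f ∈ ℤ[X]` of degree `n`, `ω` the class of `X`
in `AdjoinRoot f`, `N = Algebra.norm ℤ` (determinant of multiplication in the power basis `AdjoinRoot.powerBasis'`):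

* `norm_algebraMap_sub_root`: **`N(a − ω) = f(a)`** — `det(a·1 − C_f) = χ_{C_f}(a)` and the matrix of `ω` has
  characteristic polynomial `f` (Mathlib `Algebra.norm_eq_matrix_det`, `Matrix.eval_charpoly`,
  `charpoly_leftMulMatrix`, `minpoly ℤ ω = f`); hence `sliceNorm_affinePt`: `f(a)` is a value of every slice `m ≥ 2`
  — Bateman–Horn for `f` is the affine line `δ = 1/n` of the ladder;
* `det_scalar_sub_smul`: the homogeneous evaluation `det(x·1 − y·C) = Σᵢ χ_C[i] xⁱ yⁿ⁻ⁱ` (through `ℚ`: `yⁿ χ_C(x/y)`);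
* `norm_sub_mul_root`, `sliceNorm_binaryPt`: **`N(x − yω) = Σᵢ aᵢ xⁱ yⁿ⁻ⁱ`** (`f = Σ aᵢ Xⁱ`) — the binary slice
  `m = 2` IS the classical binary form of `f` (`δ = 2/n`);
* `binarySlice_cube_add_two`: the typed THEOREM RUNG at `(n, m) = (3, 2)`, `δ = 2/3`: Heath-Brown's theorem
  (tree named fact **parity.S18** `Literature.NumberTheory.Sieve.setOf_prime_cube_add_two_mul_cube_infinite`,
  discharged in the tree as `setOf_prime_cube_add_two_mul_cube_infinite_holds`, `ParityWave0Holds.lean`) gives the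
  binary slice cell of `f = X³ + 2` (`N(x − yω) = x³ + 2y³`).

No `sorry`, standard axioms.
-/

open Filter Finset Polynomial
open scoped Topology

open Literature.NumberTheory.Sieve

namespace Summit.Parity.BatemanHorn.Theses.OneSidedDegreeLadder.NormFormSlice

noncomputable section

/-! ## §2 The slice identity `f(a) = N(a − ω)` -/

/-- `ℤ → Matrix` algebra map is the scalar embedding (ring maps out of `ℤ` are unique). -/
theorem algebraMap_int_matrix_apply (ι : Type*) [Fintype ι] [DecidableEq ι] (a : ℤ) :
    algebraMap ℤ (Matrix ι ι ℤ) a = Matrix.scalar ι a :=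
  congrArg (fun φ : ℤ →+* Matrix ι ι ℤ => φ a) (Subsingleton.elim _ _)

/-- **The slice identity.**  For monic `f ∈ ℤ[X]`: `N_{ℤ[ω]/ℤ}(a − ω) = f(a)` — the norm is the determinant of
multiplication by `a − ω` in the power basis, i.e. `det(a·1 − C_f) = χ_{C_f}(a)`, and the companion matrix has
characteristic polynomial `f` (as in the tree's `ToralEndomorphismOfMonicPolynomial.charpoly_leftMulMatrix_root`,
re-derived from Mathlib's `charpoly_leftMulMatrix` + `minpoly ℤ ω = f`). -/
theorem norm_algebraMap_sub_root {f : ℤ[X]} (hf : f.Monic) (a : ℤ) :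
    Algebra.norm ℤ (algebraMap ℤ (AdjoinRoot f) a - AdjoinRoot.root f) = f.eval a := by
  classical
  -- `minpoly ℤ ω = f` and `χ(C_f) = f` (the tree's `ToralEndomorphismOfMonicPolynomial.minpoly_root_eq` /
  -- `charpoly_leftMulMatrix_root`, inlined here to keep the import closure inside the built snapshot)
  have hmin : minpoly ℤ (AdjoinRoot.root f) = f := by
    symm
    refine minpoly.unique' ℤ (AdjoinRoot.root f) hf ?_ fun q hq => ?_
    · rw [AdjoinRoot.aeval_eq, AdjoinRoot.mk_self]
    · refine or_iff_not_imp_right.2 fun h => ?_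
      rw [not_not, AdjoinRoot.aeval_eq, AdjoinRoot.mk_eq_zero] at h
      by_contra h0
      exact hf.not_dvd_of_degree_lt h0 hq h
  have hchar : (Algebra.leftMulMatrix (AdjoinRoot.powerBasis' hf).basis (AdjoinRoot.root f)).charpoly = f := by
    have h := charpoly_leftMulMatrix (AdjoinRoot.powerBasis' hf)
    rw [AdjoinRoot.powerBasis'_gen, hmin] at h
    exact h
  rw [Algebra.norm_eq_matrix_det (AdjoinRoot.powerBasis' hf).basis, map_sub, AlgHom.commutes,
    algebraMap_int_matrix_apply, ← Matrix.eval_charpoly, hchar]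

/-- The affine point is the element `a − ω` in every slice `m ≥ 2`. -/
theorem sliceElt_affinePt (f : ℤ[X]) {m : ℕ} (hm : 2 ≤ m) (a : ℤ) :
    sliceElt f m (affinePt a) = algebraMap ℤ (AdjoinRoot f) a - AdjoinRoot.root f := by
  unfold sliceElt affinePt
  rw [Finset.sum_eq_add 0 1 zero_ne_one]
  · simp [sub_eq_add_neg]
  · rintro c - ⟨h0, h1⟩
    simp [h0, h1]
  · intro h; exact absurd (Finset.mem_range.mpr (by omega)) h
  · intro h; exact absurd (Finset.mem_range.mpr (by omega)) h

/-- **`f(a)` is a value of every slice with `m ≥ 2`:** `sliceNorm f m (a, −1, 0, …, 0) = f(a)`. -/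
theorem sliceNorm_affinePt {f : ℤ[X]} (hf : f.Monic) {m : ℕ} (hm : 2 ≤ m) (a : ℤ) :
    sliceNorm f m (affinePt a) = f.eval a := by
  unfold sliceNorm
  rw [sliceElt_affinePt f hm, norm_algebraMap_sub_root hf]


/-! ## The binary slice `N(x − yω)` = the binary form of `f` -/

/-- **Homogeneous evaluation of the characteristic polynomial:** `det(x·1 − y·C) = Σᵢ χ_C[i] xⁱ yⁿ⁻ⁱ` over `ℤ`
(for `y ≠ 0` it is `yⁿ χ_C(x/y)`, computed in `ℚ`; for `y = 0` both sides are `xⁿ`). -/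
theorem det_scalar_sub_smul {n : ℕ} (C : Matrix (Fin n) (Fin n) ℤ) (x y : ℤ) :
    (Matrix.scalar (Fin n) x - y • C).det =
      ∑ i ∈ range (n + 1), C.charpoly.coeff i * x ^ i * y ^ (n - i) := by
  classical
  have hdeg : C.charpoly.natDegree = n := by
    rw [Matrix.charpoly_natDegree_eq_dim, Fintype.card_fin]
  have hmonic : C.charpoly.Monic := Matrix.charpoly_monic C
  rcases eq_or_ne y 0 with hy | hy
  · subst hy
    rw [zero_smul, sub_zero, Matrix.scalar_apply, Matrix.det_diagonal, Finset.prod_const, Finset.card_univ,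
      Fintype.card_fin]
    rw [Finset.sum_eq_single n]
    · have hc : C.charpoly.coeff n = 1 := by
        have := hmonic.coeff_natDegree; rwa [hdeg] at this
      rw [Nat.sub_self, pow_zero, mul_one, hc, one_mul]
    · intro i hi hne
      have hlt : i < n := lt_of_le_of_ne (by simpa [Nat.lt_succ_iff] using hi) hne
      rw [zero_pow (by omega), mul_zero]
    · intro h; exact absurd (Finset.mem_range.mpr (by omega)) h
  · apply Int.cast_injective (α := ℚ)
    have hyq : (y : ℚ) ≠ 0 := by exact_mod_cast hy
    have hM : (Int.castRingHom ℚ).mapMatrix (Matrix.scalar (Fin n) x - y • C) =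
        (y : ℚ) • (Matrix.scalar (Fin n) ((x : ℚ) / y) - C.map (Int.castRingHom ℚ)) := by
      rw [Matrix.scalar_apply, Matrix.scalar_apply]
      ext i j
      simp only [RingHom.mapMatrix_apply, Matrix.map_apply, Matrix.sub_apply, Matrix.smul_apply,
        Matrix.diagonal_apply, smul_eq_mul, eq_intCast, Int.cast_sub, Int.cast_mul, mul_sub]
      by_cases hij : i = j
      · simp [hij, mul_div_cancel₀ _ hyq]
      · simp [hij]
    have h1 : (((Matrix.scalar (Fin n) x - y • C).det : ℤ) : ℚ) =
        ((y : ℚ) • (Matrix.scalar (Fin n) ((x : ℚ) / y) - C.map (Int.castRingHom ℚ))).det := by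
      rw [← hM]; exact RingHom.map_det (Int.castRingHom ℚ) _
    rw [h1, Matrix.det_smul, Fintype.card_fin, ← Matrix.eval_charpoly, Matrix.charpoly_map,
      Polynomial.eval_map, Polynomial.eval₂_eq_sum_range, hdeg, Finset.mul_sum]
    push_cast
    refine Finset.sum_congr rfl fun i hi => ?_
    have hi' : i ≤ n := by simpa [Nat.lt_succ_iff] using hi
    rw [eq_intCast, div_pow, ← pow_sub_mul_pow (y : ℚ) hi']
    field_simp

/-- **The binary slice is the binary form of `f`.**  For monic `f = Σ aᵢ Xⁱ` of degree `n`: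
`N_{ℤ[ω]/ℤ}(x − yω) = Σᵢ aᵢ xⁱ yⁿ⁻ⁱ` (`= yⁿ f(x/y)`, the homogenisation of `f`). -/
theorem norm_sub_mul_root {f : ℤ[X]} (hf : f.Monic) (x y : ℤ) :
    Algebra.norm ℤ (algebraMap ℤ (AdjoinRoot f) x - algebraMap ℤ (AdjoinRoot f) y * AdjoinRoot.root f) =
      ∑ i ∈ range (f.natDegree + 1), f.coeff i * x ^ i * y ^ (f.natDegree - i) := by
  classical
  have hmin : minpoly ℤ (AdjoinRoot.root f) = f := by
    symm
    refine minpoly.unique' ℤ (AdjoinRoot.root f) hf ?_ fun q hq => ?_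
    · rw [AdjoinRoot.aeval_eq, AdjoinRoot.mk_self]
    · refine or_iff_not_imp_right.2 fun h => ?_
      rw [not_not, AdjoinRoot.aeval_eq, AdjoinRoot.mk_eq_zero] at h
      by_contra h0
      exact hf.not_dvd_of_degree_lt h0 hq h
  have hchar : (Algebra.leftMulMatrix (AdjoinRoot.powerBasis' hf).basis (AdjoinRoot.root f)).charpoly = f := by
    have h := charpoly_leftMulMatrix (AdjoinRoot.powerBasis' hf)
    rw [AdjoinRoot.powerBasis'_gen, hmin] at h
    exact h
  rw [Algebra.norm_eq_matrix_det (AdjoinRoot.powerBasis' hf).basis, map_sub, map_mul, AlgHom.commutes,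
    AlgHom.commutes, algebraMap_int_matrix_apply, algebraMap_int_matrix_apply,
    show Matrix.scalar _ y * Algebra.leftMulMatrix (AdjoinRoot.powerBasis' hf).basis (AdjoinRoot.root f) =
      y • Algebra.leftMulMatrix (AdjoinRoot.powerBasis' hf).basis (AdjoinRoot.root f) from by
        rw [Matrix.scalar_apply, ← Matrix.smul_eq_diagonal_mul],
    det_scalar_sub_smul, hchar, AdjoinRoot.powerBasis'_dim]

/-- The binary point is the element `x − yω` in every slice `m ≥ 2`. -/
theorem sliceElt_binaryPt (f : ℤ[X]) {m : ℕ} (hm : 2 ≤ m) (x y : ℤ) :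
    sliceElt f m (binaryPt x y) =
      algebraMap ℤ (AdjoinRoot f) x - algebraMap ℤ (AdjoinRoot f) y * AdjoinRoot.root f := by
  unfold sliceElt binaryPt
  rw [Finset.sum_eq_add 0 1 zero_ne_one]
  · simp [sub_eq_add_neg]
  · rintro c - ⟨h0, h1⟩
    simp [h0, h1]
  · intro h; exact absurd (Finset.mem_range.mpr (by omega)) h
  · intro h; exact absurd (Finset.mem_range.mpr (by omega)) h

/-- **The binary slice, typed:** `sliceNorm f m (x, −y, 0, …) = Σᵢ aᵢ xⁱ yⁿ⁻ⁱ` for monic `f` — the cell `(n, 2)`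
is literally «the binary form of `f` takes infinitely many prime values» (`δ = 2/n`). -/
theorem sliceNorm_binaryPt {f : ℤ[X]} (hf : f.Monic) {m : ℕ} (hm : 2 ≤ m) (x y : ℤ) :
    sliceNorm f m (binaryPt x y) = ∑ i ∈ range (f.natDegree + 1), f.coeff i * x ^ i * y ^ (f.natDegree - i) := by
  unfold sliceNorm
  rw [sliceElt_binaryPt f hm, norm_sub_mul_root hf]

/-- The affine point is the binary point with `y = 1`. -/
theorem affinePt_eq_binaryPt (a : ℤ) : affinePt a = binaryPt a 1 := by
  funext i
  simp [affinePt, binaryPt]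

/-- **The `(3, 2)` RUNG, typed** (`δ = 2/3`, the one theorem band-edge below `3/4`): Heath-Brown's theorem — the tree
NAMED FACT **parity.S18** `Literature.NumberTheory.Sieve.setOf_prime_cube_add_two_mul_cube_infinite` (infinitely
many primes `x³ + 2y³`; DISCHARGED in the tree: `setOf_prime_cube_add_two_mul_cube_infinite_holds`,
`ParityWave0Holds.lean`, from `CubicPrimes.HeathBrown2001_primePairCount_asymptotic_holds`) — gives the binary
slice cell of the monic cubic `f = X³ + 2` (`ω = −∛2`, `N(x − yω) = x³ + 2y³`). -/
theorem binarySlice_cube_add_two (h : setOf_prime_cube_add_two_mul_cube_infinite) :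
    (slicePrimes (X ^ 3 + C 2 : ℤ[X]) 2).Infinite := by
  have hmon : (X ^ 3 + C 2 : ℤ[X]).Monic := monic_X_pow_add_C 2 (by norm_num)
  have hdeg : (X ^ 3 + C 2 : ℤ[X]).natDegree = 3 := natDegree_X_pow_add_C
  have h' : {p : ℕ | p.Prime ∧ ∃ x y : ℕ, 0 < x ∧ 0 < y ∧ p = x ^ 3 + 2 * y ^ 3}.Infinite := h
  refine Set.Infinite.mono (fun p hp => ?_) h'
  obtain ⟨hp, a, b, -, -, hab⟩ := hp
  refine ⟨hp, binaryPt a b, ?_⟩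
  rw [sliceNorm_binaryPt hmon le_rfl, hdeg, hab]
  simp [Finset.sum_range_succ, coeff_X_pow]
  ring

end

end Summit.Parity.BatemanHorn.Theses.OneSidedDegreeLadder.NormFormSlice
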